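import Literature.NumberTheory.EllipticCurves.ZpExtension
import Literature.NumberTheory.EllipticCurves.ZpExtensionPadicUnitsProofs
import Literature.NumberTheory.GaloisRepresentations.AbsGaloisGroupCompact
import HarnessLib

/-!
# X3, the DEGENERATE rows OFF the sub-locus: a LOCALLY CONSTANT function vanishing on `ker κ` vanishes
# on a whole LAYER SUBGROUP `κ⁻¹(p^m ℤ_p)` (cell `bsd-eis`, seat `bsd-eis-x3` gen 7; STEP 1 of the
# independence argument F5 for the layer T-side classes, MEMO-9 §2.4 (f) — the input `hvan` of
# `LayerCharTower.exists_addCharOn_eq_mul`; route K1 `AdditiveBranchIMC`, crux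
# `GordTwoRankZeroOffCaseOne` — supports only)

HONEST FRAMING (`run/shared/lean/pub/bsd-eis/README.md` §4): THEOREMS ONLY (no `def`, no named fact,
no `sorry`); nothing is booked; no label, tier or count of record moves.

* `exists_layerSubgroup_subset_of_isLocallyConstant` — compactness of `Γ_K`: a locally constant
  `ψ : Γ_K → M` that vanishes on `ker κ` vanishes on some `κ⁻¹(p^m ℤ_p)` (the zero fibre is an open
  set containing the intersection of the decreasing closed sets `κ⁻¹(pⁿℤ_p)`).
References: [Washington1997] §13.1; [SerreGaloisCohomology1997] I.§1.
-/

set_option autoImplicit false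

namespace Summit.BirchSwinnertonDyer.Rank1Residual.Additive

namespace LayerCharTower

open Field Literature.NumberTheory.EllipticCurves

variable {K : Type} [Field K] {p : ℕ} [Fact p.Prime] (κ : ZpExtension K p)

/-- **STEP 1 of F5**: a locally constant `ψ : Γ_K → M` vanishing on `ker κ` vanishes on some layer
subgroup `κ⁻¹(p^m ℤ_p)` — by compactness of `Γ_K`: the closed sets `κ⁻¹(pⁿℤ_p) ∖ ψ⁻¹(ψ 1)` decrease to
`∅`. [cite: Washington1997, §13.1] [cite: SerreGaloisCohomology1997, I.§1] -/
theorem exists_layerSubgroup_subset_of_isLocallyConstant {M : Type*} [Zero M]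
    {ψ : absoluteGaloisGroup K → M} (hlc : IsLocallyConstant ψ)
    (hker : ∀ σ ∈ κ.kerSubgroup, ψ σ = 0) :
    ∃ m : ℕ, ∀ σ ∈ κ.layerSubgroup m, ψ σ = 0 := by
  haveI : CompactSpace (absoluteGaloisGroup K) :=
    Literature.NumberTheory.GaloisRepresentations.absoluteGaloisGroup_compactSpace K
  set U : Set (absoluteGaloisGroup K) := ψ ⁻¹' {0} with hU
  have hUo : IsOpen U := hlc.isOpen_fiber 0
  have hs : IsCompact Uᶜ := hUo.isClosed_compl.isCompact
  have htc : ∀ n : ℕ, IsClosed (κ.layerSubgroup n : Set (absoluteGaloisGroup K)) := fun n ↦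
    (κ.layerSubgroup n).isClosed_of_isOpen (κ.isOpen_layerSubgroup n)
  have hst : Uᶜ ∩ ⋂ n : ℕ, (κ.layerSubgroup n : Set (absoluteGaloisGroup K)) = ∅ := by
    ext σ
    simp only [Set.mem_inter_iff, Set.mem_compl_iff, Set.mem_iInter, SetLike.mem_coe,
      Set.mem_empty_iff_false, iff_false, not_and, not_forall]
    intro hσU
    by_contra hall
    push Not at hall
    -- `⋂ₙ κ⁻¹(pⁿℤ_p) = ker κ` (cf. `X11b.AcSelmer.mem_kerSubgroup_of_forall_mem_layerSubgroup`)
    have hkerσ : σ ∈ κ.kerSubgroup := by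
      rw [ZpExtension.mem_kerSubgroup]
      have h0 : (κ σ).toAdd = 0 :=
        ZpExtension.PadicUnits.eq_zero_of_forall_pow_dvd fun n ↦
          ZpExtension.mem_layerSubgroup.mp (hall n)
      exact toAdd_eq_zero.mp h0
    exact hσU (hker σ hkerσ)
  have hdt : Directed (· ⊇ ·) fun n : ℕ ↦ (κ.layerSubgroup n : Set (absoluteGaloisGroup K)) :=
    fun i j ↦ ⟨max i j, κ.layerSubgroup_antitone (le_max_left i j),
      κ.layerSubgroup_antitone (le_max_right i j)⟩
  obtain ⟨m, hm⟩ := hs.elim_directed_family_closed _ htc hst hdt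
  refine ⟨m, fun σ hσ ↦ ?_⟩
  by_contra hne
  have : σ ∈ Uᶜ ∩ (κ.layerSubgroup m : Set (absoluteGaloisGroup K)) := ⟨hne, hσ⟩
  rw [hm] at this
  exact this

end LayerCharTower

end Summit.BirchSwinnertonDyer.Rank1Residual.Additive
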